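import Literature.Algebra.EuclideanLattices.ScaledIntLattice
import Literature.Probability.Distributions.GaussianLinearCompensation
import HarnessLib

/-!
# Linear algebra on `q⁻¹ℤⁿ`: additivity of the numerators and the class map, and integer matrices acting on `q⁻¹ℤⁿ`

Topic `Algebra/EuclideanLattices` (family `pqc`); complements `ScaledIntLattice.lean`
(`invScaledIntLattice n q = q⁻¹ℤⁿ`, `num` = integer numerators `q·yⱼ`, `torusClass` = `(q yⱼ mod q)ⱼ`,
`torusRep` = canonical lift of `a ∈ ℤ_qⁿ`). Proved algebra (no named fact) for the packaging of BLPRS 2013,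
Lemma 4.7 (`LWEFelToExtLWEKernel.lean`, pqc.S21,
`Literature.Computability.Cryptography.blprs_gapSVP_sqrt_dim_to_lwe_classical`), whose transformation
applies the unimodular integer matrix `U` to torus vectors and reads lattice points modulo `ℤᵐ`:

> *"`b' = Ub + f` … `A' = AUᵀ` … the coset `q⁻¹ℤᵐ - b'` is identical to `q⁻¹ℤᵐ - (Ue + f)`"*
> (arXiv:1306.0281, proof of Lemma 4.7): at the level of the objects of `ScaledIntLattice.lean`,
> `U·ā ∈ q⁻¹ℤᵐ` for the lift `ā` of `a = Aᵀs`, its numerators are `U·(aⱼ)` and its class is `U a`.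

## Results

* `num_add`, `num_zero`, `num_neg`, `num_sub`, `num_injective`; `torusClass_add`, `torusClass_neg`;
  `torusRepL a` (the lift as a lattice vector), `num_torusRepL` (`= val ∘ a`);
* `ofLp_matrixCLM_intCast_mem` / **`intMatrixAct U : q⁻¹ℤⁿ →+ q⁻¹ℤⁿ`** (`x ↦ Ux` for an integer matrix
  `U`, through `matrixCLM (U.map Int.cast)`), `coe_intMatrixAct`, **`num_intMatrixAct`**
  (`num (Ux) = U·num x`), **`torusClass_intMatrixAct`** (`= (U mod q)·torusClass x`), and
  `torusClass_intMatrixAct_torusRepL` (`torusClass (U ā) = (U mod q)·a`).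

## References

* Z. Brakerski, A. Langlois, C. Peikert, O. Regev, D. Stehlé, *Classical hardness of learning with errors*,
  STOC 2013; arXiv:1306.0281, §2.3 and the proof of Lemma 4.7.
-/

noncomputable section

open Module Submodule Matrix Literature.Probability.Distributions

namespace Literature.Algebra.EuclideanLattices

variable (n q : ℕ) [NeZero q]

/-! ### Additivity of `num` and `torusClass` -/

/-- `q ≠ 0` in `ℝ`. [folklore] -/
theorem natCast_modulus_ne_zero : (q : ℝ) ≠ 0 := by exact_mod_cast NeZero.ne q

/-- The numerators are additive. [folklore] -/
theorem num_add (y y' : invScaledIntLattice n q) : num n q (y + y') = num n q y + num n q y' := by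
  funext j
  have h : ((num n q (y + y') j : ℤ) : ℝ) = ((num n q y j + num n q y' j : ℤ) : ℝ) := by
    push_cast
    rw [num_spec, num_spec, num_spec, Submodule.coe_add, PiLp.add_apply, mul_add]
  exact_mod_cast h

/-- The numerators of `0` vanish. [folklore] -/
theorem num_zero : num n q (0 : invScaledIntLattice n q) = 0 := by
  funext j
  have h : ((num n q (0 : invScaledIntLattice n q) j : ℤ) : ℝ) = ((0 : ℤ) : ℝ) := by
    rw [num_spec, Submodule.coe_zero, PiLp.zero_apply, mul_zero, Int.cast_zero]
  exact_mod_cast h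

/-- The numerators of a negative. [folklore] -/
theorem num_neg (y : invScaledIntLattice n q) : num n q (-y) = -num n q y := by
  have h := num_add n q y (-y)
  rw [add_neg_cancel, num_zero] at h
  funext j
  have hj := congrFun h j
  simp only [Pi.zero_apply, Pi.add_apply] at hj
  simp only [Pi.neg_apply]
  linarith

/-- The numerators of a difference. [folklore] -/
theorem num_sub (y y' : invScaledIntLattice n q) : num n q (y - y') = num n q y - num n q y' := by
  rw [sub_eq_add_neg, num_add, num_neg, sub_eq_add_neg]

/-- The numerators determine the lattice vector. [folklore] -/
theorem num_injective : Function.Injective (num n q : invScaledIntLattice n q → Fin n → ℤ) := by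
  intro y y' h
  apply Subtype.ext
  apply (WithLp.ofLp_injective 2)
  funext j
  have hy := num_spec n q y j
  have hy' := num_spec n q y' j
  rw [h] at hy
  have := hy.symm.trans hy'
  exact mul_left_cancel₀ (natCast_modulus_ne_zero q) this

/-- **The class map is additive**: `torusClass (y + y') = torusClass y + torusClass y'`. [folklore] -/
theorem torusClass_add (y y' : invScaledIntLattice n q) :
    torusClass n q (y + y') = torusClass n q y + torusClass n q y' := by
  funext j
  simp only [torusClass, Pi.add_apply, num_add, Int.cast_add]

/-- The class of a negative. [folklore] -/
theorem torusClass_neg (y : invScaledIntLattice n q) : torusClass n q (-y) = -torusClass n q y := by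
  funext j
  simp only [torusClass, Pi.neg_apply, num_neg, Int.cast_neg]

/-- The canonical lift `ā` of `a ∈ ℤ_qⁿ` as a vector of `q⁻¹ℤⁿ`. [cite: BrakerskiEtAl2013, §2.3] -/
def torusRepL (a : Fin n → ZMod q) : invScaledIntLattice n q := ⟨torusRep n q a, torusRep_mem n q a⟩

/-- The numerators of the lift are the canonical integer lifts `val aⱼ`. [folklore] -/
theorem num_torusRepL (a : Fin n → ZMod q) : num n q (torusRepL n q a) = fun j => ((a j).val : ℤ) := by
  funext j
  have h : ((num n q (torusRepL n q a) j : ℤ) : ℝ) = ((((a j).val : ℤ)) : ℝ) := by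
    rw [num_spec]
    change (q : ℝ) * torusRep n q a j = _
    rw [torusRep_apply, mul_div_cancel₀ _ (natCast_modulus_ne_zero q)]
    push_cast
    rfl
  exact_mod_cast h

/-- The class of the lift is `a` (restated for `torusRepL`). [folklore] -/
theorem torusClass_torusRepL (a : Fin n → ZMod q) : torusClass n q (torusRepL n q a) = a :=
  torusClass_torusRep n q a

/-! ### Integer matrices act on `q⁻¹ℤⁿ` -/

/-- An integer matrix maps `q⁻¹ℤⁿ` into itself (coordinates: `q (Ux)ᵢ = ∑ⱼ Uᵢⱼ (q xⱼ) ∈ ℤ`).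
[cite: BrakerskiEtAl2013, Lemma 4.7 (proof: "b' = Ub + f", U unimodular integer)] -/
theorem matrixCLM_intCast_mem (U : Matrix (Fin n) (Fin n) ℤ) (x : invScaledIntLattice n q) :
    matrixCLM (U.map (Int.cast : ℤ → ℝ)) (x : EuclideanSpace ℝ (Fin n)) ∈ invScaledIntLattice n q := by
  rw [mem_invScaledIntLattice_iff]
  intro i
  refine ⟨(U *ᵥ num n q x) i, ?_⟩
  rw [ofLp_matrixCLM, mulVec, mulVec, dotProduct, dotProduct, Int.cast_sum, Finset.mul_sum]
  refine Finset.sum_congr rfl fun j _ => ?_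
  rw [Int.cast_mul, num_spec, Matrix.map_apply]
  change _ = (q : ℝ) * ((U i j : ℝ) * (x : EuclideanSpace ℝ (Fin n)) j)
  ring

/-- **The action of an integer matrix on `q⁻¹ℤⁿ`** as an additive homomorphism. [cite: BrakerskiEtAl2013, Lemma 4.7 (proof)] -/
def intMatrixAct (U : Matrix (Fin n) (Fin n) ℤ) : invScaledIntLattice n q →+ invScaledIntLattice n q where
  toFun x := ⟨matrixCLM (U.map (Int.cast : ℤ → ℝ)) (x : EuclideanSpace ℝ (Fin n)), matrixCLM_intCast_mem n q U x⟩
  map_zero' := by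
    apply Subtype.ext
    change matrixCLM (U.map (Int.cast : ℤ → ℝ)) ((0 : invScaledIntLattice n q) : EuclideanSpace ℝ (Fin n)) = _
    rw [Submodule.coe_zero, map_zero]
  map_add' x y := by
    apply Subtype.ext
    change matrixCLM (U.map (Int.cast : ℤ → ℝ)) ((x + y : invScaledIntLattice n q) : EuclideanSpace ℝ (Fin n)) = _
    rw [Submodule.coe_add, map_add]
    rfl

/-- Unfolding: `(intMatrixAct U x : E) = matrixCLM U x`. [folklore] -/
theorem coe_intMatrixAct (U : Matrix (Fin n) (Fin n) ℤ) (x : invScaledIntLattice n q) :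
    ((intMatrixAct n q U x : invScaledIntLattice n q) : EuclideanSpace ℝ (Fin n)) =
      matrixCLM (U.map (Int.cast : ℤ → ℝ)) (x : EuclideanSpace ℝ (Fin n)) := rfl

/-- **Numerators transform by `U`**: `num (Ux) = U · num x`. [cite: BrakerskiEtAl2013, Lemma 4.7 (proof)] -/
theorem num_intMatrixAct (U : Matrix (Fin n) (Fin n) ℤ) (x : invScaledIntLattice n q) :
    num n q (intMatrixAct n q U x) = U *ᵥ num n q x := by
  funext i
  have h : ((num n q (intMatrixAct n q U x) i : ℤ) : ℝ) = (((U *ᵥ num n q x) i : ℤ) : ℝ) := by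
    rw [num_spec, coe_intMatrixAct]
    rw [ofLp_matrixCLM, mulVec, mulVec, dotProduct, dotProduct, Int.cast_sum, Finset.mul_sum]
    refine Finset.sum_congr rfl fun j _ => ?_
    rw [Int.cast_mul, num_spec, Matrix.map_apply]
    change (q : ℝ) * ((U i j : ℝ) * (x : EuclideanSpace ℝ (Fin n)) j) = _
    ring
  exact_mod_cast h

/-- **Classes transform by `U mod q`**: `torusClass (Ux) = (U mod q) · torusClass x`. [cite: BrakerskiEtAl2013, Lemma 4.7 (proof: "A' = AUᵀ")] -/
theorem torusClass_intMatrixAct (U : Matrix (Fin n) (Fin n) ℤ) (x : invScaledIntLattice n q) :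
    torusClass n q (intMatrixAct n q U x) = U.map (Int.cast : ℤ → ZMod q) *ᵥ torusClass n q x := by
  funext i
  simp only [torusClass, num_intMatrixAct, mulVec, dotProduct, Matrix.map_apply, Int.cast_sum, Int.cast_mul]

/-- The class of `U ā` is `(U mod q) · a`. [cite: BrakerskiEtAl2013, Lemma 4.7 (proof)] -/
theorem torusClass_intMatrixAct_torusRepL (U : Matrix (Fin n) (Fin n) ℤ) (a : Fin n → ZMod q) :
    torusClass n q (intMatrixAct n q U (torusRepL n q a)) = U.map (Int.cast : ℤ → ZMod q) *ᵥ a := by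
  rw [torusClass_intMatrixAct, torusClass_torusRepL]

/-- The numerators of `U ā` are `U · (val aⱼ)ⱼ`. [cite: BrakerskiEtAl2013, Lemma 4.7 (proof)] -/
theorem num_intMatrixAct_torusRepL (U : Matrix (Fin n) (Fin n) ℤ) (a : Fin n → ZMod q) :
    num n q (intMatrixAct n q U (torusRepL n q a)) = U *ᵥ fun j => ((a j).val : ℤ) := by
  rw [num_intMatrixAct, num_torusRepL]

end Literature.Algebra.EuclideanLattices

end
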